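import Summits.BirchSwinnertonDyer.BirchSwinnertonDyer.Theorems.KimAtThreeShallowEqDeepPortRows
import Summits.BirchSwinnertonDyer.BirchSwinnertonDyer.Theorems.KimAtThreeShallowEqDeepResidualSeam
import Summits.BirchSwinnertonDyer.BirchSwinnertonDyer.Theorems.KimAtThreeShallowEqDeepResidualLeaf
import HarnessLib

/-!
# Route `KimAtThreeKolyvagin` (W2), cruxes `ShallowEqDeepOffKatoStratum` (19599) and `ShallowEqDeepAtTorsionFree`
# (19077) BY NAME, and the route's LEAF, from PUBLISHED named facts + the Kato–Kurihara ports ALONE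

Cell `bsd-addord`, seat `bsd-addord-w2-c4` (gen 7, owner of item 19599; item 19077).  `--supports` 19077.
HONEST FRAMING. TOOL theorems only (no definition, no named fact, no `sorry`); nothing asserted about any curve,
nothing booked; 19599 / 19077 / 19562 / 19560 stay OPEN; BSD is not proved by any of this.  The ONE displayed
hypothesis of this file beyond PUBLISHED facts and the route's alias item 19678 `KatoStratumSharedParts` (Sakamoto
×2, GZK, Poitou–Tate, Carayol by name + crux 19560 = PORT″) is **PORT@3-OFF** (`hPortOff`, section variable):
«for every tower-surjective `W₀` with `E(ℚ₃)[3] = 0`, every place `v₃ ∣ 3` and generator family `η`, and every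
lattice-optimal datum `P` at the conductor whose row is NOT on the Kato stratum (¬(Addv ∧ 3 ∤ c₃ ∧ 3 ∤ c_P)):
for SOME exponent `e`, the UNLOCKED shared-generator two-depth Kato–Kurihara dictionary at `P`» (the bare
witness clauses `KimAtThreeKolyvaginDefs.KatoKuriharaWitnessAtTwoExp W₀ · 0 e · v₃ P` + (COMP) for all depths
`k ≤ k′`, all `τ`-data canonical for `η`, every pinned reduction).  It is crux 19560's statement with the Kato
stratum replaced by its complement and the port unlocked; FLAG `K22-Thm3.13-PORT@3`, NOT in print at `3` (Kim AJM
148 Thm. 3.13 is `p ≥ 5`; Kim–Pollack 2025 §4.2 up to a uniform constant, PRE).  On the additive-defect rows it is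
implied by acc6's PORT₂-SHARED; on the good / multiplicative rows it is the object of definition item
`defn-KatoKuriharaDictionaryThreeNonAddAt` (Kim's Lemma 3.3 / 3.8 lattice + Kato Thm. 12.5 (1) + MR App. A (33)).

WHAT (all from `KimAtThreeShallowEqDeepPortRows`, i.e. from acc6's two-exponent END re-keyed on the unlocked port
and acc1's free-exponent upper row):
* `residualOff_of_portOff` — w2-c4 g6's displayed residual (R)_off (the planner's candidate item text
  `ResidualOffKatoStratum`, HOME/w2c4/RESIDUAL-OFF-SIGNATURE-g7.md) ⟸ PUB ∧ PORT@3-OFF;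
* **`shallowEqDeepOffKatoStratum_of_portOff : … → ShallowEqDeepOffKatoStratum`** — crux 19599 BY NAME ⟸
  [S24] (1)(2) ∧ GZK ∧ PT ∧ PORT@3-OFF (no twin 19562, no TamDiv∞, no (DD));
* `deepUpperOff_torsionFree_of_portOff` / `deepLowerOff_torsionFree_of_portOff` — the twins 19562 / 19679 on
  their `E(ℚ₃)[3] = 0` rows ⟸ the same;
* **`shallowEqDeepAtTorsionFree_of_sharedParts_of_portOff : KatoStratumSharedParts → ShallowEqDeepAtTorsionFree`**
  — crux 19077 BY NAME ⟸ alias 19678 ∧ PORT@3-OFF;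
* `deepUpper₀_classwide_of_sharedParts_of_portOff` — crux 19076's statement on its `E(ℚ₃)[3] = 0` rows,
  class-wide, ⟸ alias 19678 ∧ PORT@3-OFF;
* **`kimAtThreeRankZeroPUB_of_sharedParts_of_portOff : KatoStratumSharedParts → N11.KimAtThreeRankZeroPUB`** —
  THE ROUTE'S LEAF ⟸ alias 19678 ∧ PORT@3-OFF: W2 = {PUB} + {PORT″ on the Kato stratum (crux 19560)} +
  {PORT@3 off it}, ONE debt class; 19562, 19679, 19599, 19075–19077, (R), TamDiv∞ are not inputs.
References: [Kim2022StructureSelmer] Thm. 1.9 (6), Thm. 3.13, Lemma 3.3, 3.8; [Kim2025RefinedTNC] Thm 1.1/1.2, §4.2;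
[Sakamoto2024] Thm. 4.4; [MazurRubin2004] Thm. 4.4.1, 5.2.12; [Kato2004Asterisque] Thm. 12.5 (1); [Carayol1986];
[EdixhovenManin1991] Prop. 2.
-/

set_option autoImplicit false
-- the Theorems namespace of a single-conjunct summit repeats the summit name by design (D-0017)
set_option linter.dupNamespace false

noncomputable section

namespace Summit.BirchSwinnertonDyer.BirchSwinnertonDyer.Theorems.KimAtThreeShallowEqDeepPortSeam

open scoped Classical NumberField ContRepresentation
open Function IsDedekindDomain NumberField WeierstrassCurve CongruenceSubgroup
  Literature.NumberTheory.EllipticCurves Literature.NumberTheory.EllipticCurves.ModularForms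
  Literature.NumberTheory.EllipticCurves.Rank1Residual
  Literature.NumberTheory.GaloisRepresentations
  Literature.NumberTheory.GaloisRepresentations.DiscreteGaloisModule Literature.NumberTheory.GaloisCohomology
  Summit.BirchSwinnertonDyer.Rank1Residual.GaloisImage
  Summit.BirchSwinnertonDyer.Rank1Residual.Additive
  Summit.BirchSwinnertonDyer.BirchSwinnertonDyer.Theses.KimAtThreeKolyvagin
  Summit.BirchSwinnertonDyer.BirchSwinnertonDyer.Theorems
  Summit.BirchSwinnertonDyer.BirchSwinnertonDyer.Theorems.KimAtThreeKolyvaginDefs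
  Summit.BirchSwinnertonDyer.BirchSwinnertonDyer.Theorems.KimAtThreeDeepLowerKatoStratumOfFacts
  Summit.BirchSwinnertonDyer.BirchSwinnertonDyer.Theorems.KimAtThreeShallowEqDeepNoStubCruxes
  Summit.BirchSwinnertonDyer.BirchSwinnertonDyer.Theorems.KimAtThreeShallowEqDeepSplitGlueNoStub
  Summit.BirchSwinnertonDyer.BirchSwinnertonDyer.Theorems.KimAtThreeKolyvaginIsogenyInvariance
  Summit.BirchSwinnertonDyer.BirchSwinnertonDyer.Theorems.KimAtThreeKolyvaginIsogenyTransport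
  Summit.BirchSwinnertonDyer.BirchSwinnertonDyer.Theorems.KimAtThreeKolyvaginIsogenyCruxes
  Summit.BirchSwinnertonDyer.BirchSwinnertonDyer.Theorems.KimAtThreeKolyvaginUnitLevelOneRungs
  Summit.BirchSwinnertonDyer.BirchSwinnertonDyer.Theorems.KimAtThreeKolyvaginCertificateDictionary
  Summit.BirchSwinnertonDyer.BirchSwinnertonDyer.Theorems.KimAtThreeShallowEqDeepOffStratumSockets
  Summit.BirchSwinnertonDyer.BirchSwinnertonDyer.Theorems.KimAtThreeDeepLowerSplitGlueItem
  Summit.BirchSwinnertonDyer.BirchSwinnertonDyer.Theorems.KimAtThreeShallowEqDeepPortRows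
  Summit.BirchSwinnertonDyer.BirchSwinnertonDyer.Theorems.KimAtThreeShallowEqDeepResidualSeam
  Summit.BirchSwinnertonDyer.BirchSwinnertonDyer.Theorems.KimAtThreeShallowEqDeepResidualLeaf

/-! ### §0 The leaf from a class-wide UPPER row on the `E(ℚ₃)[3] = 0` rows and (R)_all -/

/-- **LEAF ⟸ 19076's statement RESTRICTED to `E(ℚ₃)[3] = 0` ∧ (R)_all** (w2-c4 g6
`KimAtThreeShallowEqDeepResidualLeaf.kimAtThreeRankZeroPUB_of_upper_of_residual` with the upper hypothesis asked
only where the leaf reads it): at a row `s + d ≤ a ≤ s + ∂ ≤ s + d`. [cite: Kim2025RefinedTNC, Thm. 1.1]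
[cite: Kim2022StructureSelmer, Thm. 1.9 (6), §1.5.1] [cite: MazurRubin2004, Def. 5.2.11, Thm. 5.2.12 (i)] -/
theorem kimAtThreeRankZeroPUB_of_upper₀_of_residual
    (hU : ∀ (W : WeierstrassCurve ℚ) [W.IsElliptic] [W.IsGloballyMinimal],
        (∀ n : ℕ, W.HasSurjectiveModNGaloisRep (3 ^ n : ℕ)) →
        Nat.card {Q : (W.baseChange ℚ_[3]).toAffine.Point // (3 : ℕ) • Q = 0} = 1 →
        Finite W.sha →
        ∀ {N : ℕ} [NeZero N] (f : CuspForm (Gamma0 N) 2), IsNewformOf W f →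
        (∀ r : ℚ, ratPlusSymbol f r ≠ 0 → 0 ≤ padicValRat 3 (ratPlusSymbol f r)) →
        kuriharaVanishingOrder W 3 f = 0 →
          ∃ d : ℕ, kuriharaPartialDeepInfty W 3 f = d ∧
            ((padicValNat 3 (Nat.card (AddCommGroup.primaryComponent W.sha 3)) + d : ℕ) : ℕ∞) ≤
              kuriharaPartial W 3 f 0)
    (hR : ∀ (W : WeierstrassCurve ℚ) [W.IsElliptic] [W.IsGloballyMinimal],
        (∀ n : ℕ, W.HasSurjectiveModNGaloisRep (3 ^ n : ℕ)) →
        Nat.card {Q : (W.baseChange ℚ_[3]).toAffine.Point // (3 : ℕ) • Q = 0} = 1 →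
        Finite W.sha →
        ∀ {N : ℕ} [NeZero N] (f : CuspForm (Gamma0 N) 2), IsNewformOf W f →
        (∀ r : ℚ, ratPlusSymbol f r ≠ 0 → 0 ≤ padicValRat 3 (ratPlusSymbol f r)) →
        kuriharaVanishingOrder W 3 f = 0 →
          kuriharaPartial W 3 f 0 ≤
            (padicValNat 3 (Nat.card (AddCommGroup.primaryComponent W.sha 3)) : ℕ∞) +
              kuriharaPartialInfty W 3 f) :
    N11.KimAtThreeRankZeroPUB := by
  intro W _ _ htower ht0 hfin N _ f hf hint hord
  obtain ⟨d, hd, hge⟩ := hU W htower ht0 hfin f hf hint hord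
  have hle := hR W htower ht0 hfin f hf hint hord
  set s := padicValNat 3 (Nat.card (AddCommGroup.primaryComponent W.sha 3)) with hs
  have hpd : kuriharaPartialInfty W 3 f ≤ (d : ℕ∞) := by
    rw [← hd]
    exact kuriharaPartialInfty_le_kuriharaPartialDeepInfty W 3 f
  have hptop : kuriharaPartialInfty W 3 f ≠ ⊤ := ne_top_of_le_ne_top (ENat.coe_ne_top d) hpd
  obtain ⟨j, hj⟩ : ∃ j : ℕ, kuriharaPartialInfty W 3 f = j :=
    (ENat.ne_top_iff_exists.mp hptop).imp fun j h => h.symm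
  have hjd : j ≤ d := by
    rw [hj] at hpd
    exact_mod_cast hpd
  have hchain : ((s + d : ℕ) : ℕ∞) ≤ (s : ℕ∞) + (j : ℕ∞) := by
    rw [← hj]
    exact hge.trans hle
  have hdj : d ≤ j := by
    have : s + d ≤ s + j := by exact_mod_cast hchain
    omega
  have hjd' : j = d := le_antisymm hjd hdj
  refine ⟨d, ?_, le_antisymm ?_ hge⟩
  · rw [hj, hjd']
  · calc kuriharaPartial W 3 f 0 ≤ (s : ℕ∞) + kuriharaPartialInfty W 3 f := hle
      _ = ((s + d : ℕ) : ℕ∞) := by rw [hj, hjd', Nat.cast_add]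

/-! ### §1 The off-stratum cruxes from PUB + PORT@3-OFF -/

section PortOff

variable
  (hPortOff : ∀ (W₀ : WeierstrassCurve ℚ) [W₀.IsElliptic] [W₀.IsGloballyMinimal],
    (∀ n : ℕ, W₀.HasSurjectiveModNGaloisRep (3 ^ n : ℕ)) →
    Nat.card {Q : (W₀.baseChange ℚ_[3]).toAffine.Point // (3 : ℕ) • Q = 0} = 1 →
    ∀ (v₃ : HeightOneSpectrum (𝓞 ℚ)), ((3 : ℕ) : 𝓞 ℚ) ∈ v₃.asIdeal →
    ∀ (η : (q : HeightOneSpectrum (𝓞 ℚ)) → (ZMod (Ideal.absNorm q.asIdeal))ˣ),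
      (∀ q, Subgroup.zpowers (η q) = ⊤) →
    ∀ {N : ℕ} [NeZero N] (P : ModularParametrizationData W₀ N), N = W₀.conductorNorm ℤ →
      (∀ z ∈ P.L.lattice, ∃ w ∈ periodLattice P.f, z = P.c * w) →
      ¬ ((haveI : Fact (Nat.Prime 3) := ⟨Nat.prime_three⟩; Addv W₀ 3) ∧
          ¬ 3 ∣ (W₀.baseChange ℚ_[3]).localTamagawaNumber ℤ_[3] ∧ ¬ (3 : ℤ) ∣ P.maninConstant) →
      ∃ e : ℕ, ∀ (k k' : ℕ)
        (Dk : KolyvaginDatum (W₀.torsionGaloisModule (((3 : ℕ) : ℤ) ^ k * ((3 : ℕ) : ℤ))))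
        (Dk' : KolyvaginDatum (W₀.torsionGaloisModule (((3 : ℕ) : ℤ) ^ k' * ((3 : ℕ) : ℤ))))
        (red : (W₀.torsionGaloisModule (((3 : ℕ) : ℤ) ^ k' * ((3 : ℕ) : ℤ))).toContRepresentation →ⁱL
          (W₀.torsionGaloisModule (((3 : ℕ) : ℤ) ^ k * ((3 : ℕ) : ℤ))).toContRepresentation),
        Dk.IsCanonicalTauDatumThreeAtWith W₀ k k η → Dk'.IsCanonicalTauDatumThreeAtWith W₀ k' k' η → k ≤ k' →
        (∀ x : geomTorsion W₀ (((3 : ℕ) : ℤ) ^ k' * ((3 : ℕ) : ℤ)),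
          ((red x : geomTorsion W₀ (((3 : ℕ) : ℤ) ^ k * ((3 : ℕ) : ℤ))) : geomPoints W₀) =
            (((3 : ℕ) : ℤ) ^ (k' - k)) • (x : geomPoints W₀)) →
        ∃ κ Λ κ' κu Λu κu',
          KatoKuriharaWitnessAtTwoExp W₀ k 0 e Dk v₃ P κ Λ κ' ∧
          KatoKuriharaWitnessAtTwoExp W₀ k' 0 e Dk' v₃ P κu Λu κu' ∧
          ∀ d, Dk'.IsLevel d → Dk.IsLevel d →
            galoisCohomology.map red 1 (κu d) = κ d ∧ galoisCohomology.map red 1 (κu' d) = κ' d)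

include hPortOff

/-- **(R)_off ⟸ PUB ∧ PORT@3-OFF.**  The displayed residual of w2-c4 g6 (`KimAtThreeShallowEqDeepOffStratumResidual`,
binder `hR`; the planner's candidate first-layer item `ResidualOffKatoStratum`) is a THEOREM granted [S24] (1)(2),
GZK, Poitou–Tate and the off-stratum port: `residual_row_of_portUnlocked` at the row's own `(v₃, η)`
(`exists_place_three_and_generators`). [cite: Kim2022StructureSelmer, Thm. 1.9 (6), §1.5.1]
[cite: Kim2025RefinedTNC, Thm 1.1] [cite: Sakamoto2024, Thm. 4.4 (p. 926)] [cite: MilneADT2006, Ch. I, Thm. 4.10] -/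
theorem residualOff_of_portOff
    (hS24 : Sakamoto2024.kolyvaginSystems_freeRankOne_zmod_three_pow)
    (hS24₂ : Sakamoto2024.kolyvaginSystems_idealOfBasis_eq_fittingIdeal_zmod_three_pow)
    (hGZK : rank_eq_analyticRank_of_analyticRank_le_one) (hPT : poitouTate_selmerStructure_duality ℚ) :
    ∀ (W₀ : WeierstrassCurve ℚ) [W₀.IsElliptic] [W₀.IsGloballyMinimal],
      (∀ n : ℕ, W₀.HasSurjectiveModNGaloisRep (3 ^ n : ℕ)) →
      Nat.card {Q : (W₀.baseChange ℚ_[3]).toAffine.Point // (3 : ℕ) • Q = 0} = 1 → Finite W₀.sha →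
      ∀ {N : ℕ} [NeZero N], N = W₀.conductorNorm ℤ →
      ∀ (D₀ : ModularParametrizationData W₀ N),
        (∀ z ∈ D₀.L.lattice, ∃ w ∈ periodLattice D₀.f, z = D₀.c * w) →
        (∀ (W₂ : WeierstrassCurve ℚ) [W₂.IsElliptic] (D₂ : ModularParametrizationData W₂ N),
          D₂.f = D₀.f → D₀.modularDegree ≤ D₂.modularDegree) →
        (∀ r : ℚ, ratPlusSymbol D₀.f r ≠ 0 → 0 ≤ padicValRat 3 (ratPlusSymbol D₀.f r)) →
        kuriharaVanishingOrder W₀ 3 D₀.f = 0 →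
        ¬ ((haveI : Fact (Nat.Prime 3) := ⟨Nat.prime_three⟩; Addv W₀ 3) ∧
            ¬ 3 ∣ (W₀.baseChange ℚ_[3]).localTamagawaNumber ℤ_[3] ∧ ¬ (3 : ℤ) ∣ D₀.maninConstant) →
        kuriharaPartial W₀ 3 D₀.f 0 ≤
          (padicValNat 3 (Nat.card (AddCommGroup.primaryComponent W₀.sha 3)) : ℕ∞) +
            kuriharaPartialInfty W₀ 3 D₀.f := by
  intro W₀ _ _ htow ht _ N _ hN D₀ hopt _ _ hord hoff
  obtain ⟨v₃, η, hv₃, hη⟩ := exists_place_three_and_generators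
  obtain ⟨e, hPort⟩ := hPortOff W₀ htow ht v₃ hv₃ η hη D₀ hN hopt hoff
  exact residual_row_of_portUnlocked hS24 hS24₂ hGZK hPT W₀ htow D₀ e hord v₃ hv₃ η hη hPort hN

/-- **Crux 19599 `ShallowEqDeepOffKatoStratum` BY NAME ⟸ [S24] (1)(2) ∧ GZK ∧ Poitou–Tate ∧ PORT@3-OFF.**
At each of its rows: `shallowEqDeep_row_of_portUnlocked` (upper row + (R) through the socket).  No twin 19562,
no TamDiv∞, no (DD), no Kato-stratum binder. [cite: Kim2025RefinedTNC, Thm 1.1, Thm 1.2]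
[cite: Kim2022StructureSelmer, Thm. 1.9 (6), Thm. 3.13] [cite: Sakamoto2024, Thm. 4.4 (p. 926)]
[cite: MazurRubin2004, Thm. 4.4.1 and Thm. 5.2.12] [cite: MilneADT2006, Ch. I, Thm. 4.10] -/
theorem shallowEqDeepOffKatoStratum_of_portOff
    (hS24 : Sakamoto2024.kolyvaginSystems_freeRankOne_zmod_three_pow)
    (hS24₂ : Sakamoto2024.kolyvaginSystems_idealOfBasis_eq_fittingIdeal_zmod_three_pow)
    (hGZK : rank_eq_analyticRank_of_analyticRank_le_one) (hPT : poitouTate_selmerStructure_duality ℚ) :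
    ShallowEqDeepOffKatoStratum := by
  intro W₀ _ _ htow ht _ N _ hN D₀ hopt _ hint hord hoff
  obtain ⟨v₃, η, hv₃, hη⟩ := exists_place_three_and_generators
  obtain ⟨e, hPort⟩ := hPortOff W₀ htow ht v₃ hv₃ η hη D₀ hN hopt hoff
  exact shallowEqDeep_row_of_portUnlocked hS24 hS24₂ hGZK hPT W₀ htow D₀ e hint hord v₃ hv₃ η hη hPort hN

/-- **The UPPER twin 19562 `DeepUpperAtThreeOffKatoStratum` on its `E(ℚ₃)[3] = 0` rows ⟸ PUB ∧ PORT@3-OFF**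
(displayed: the crux's text with the binder `#E(ℚ₃)[3] = 1` added and its stratum condition accordingly
shortened). [cite: Kim2025RefinedTNC, Thm 1.1, §5] [cite: Kim2022StructureSelmer, Thm. 1.9 (6), Thm. 3.13]
[cite: Sakamoto2024, Thm. 4.4 (1)(2) (p. 926)] [cite: MazurRubin2004, Thm. 4.4.1] -/
theorem deepUpperOff_torsionFree_of_portOff
    (hS24 : Sakamoto2024.kolyvaginSystems_freeRankOne_zmod_three_pow)
    (hS24₂ : Sakamoto2024.kolyvaginSystems_idealOfBasis_eq_fittingIdeal_zmod_three_pow)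
    (hGZK : rank_eq_analyticRank_of_analyticRank_le_one) (hPT : poitouTate_selmerStructure_duality ℚ) :
    ∀ (W₀ : WeierstrassCurve ℚ) [W₀.IsElliptic] [W₀.IsGloballyMinimal],
      (∀ n : ℕ, W₀.HasSurjectiveModNGaloisRep (3 ^ n : ℕ)) →
      Nat.card {Q : (W₀.baseChange ℚ_[3]).toAffine.Point // (3 : ℕ) • Q = 0} = 1 → Finite W₀.sha →
      ∀ {N : ℕ} [NeZero N], N = W₀.conductorNorm ℤ →
      ∀ (D₀ : ModularParametrizationData W₀ N),
        (∀ z ∈ D₀.L.lattice, ∃ w ∈ periodLattice D₀.f, z = D₀.c * w) →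
        (∀ (W₂ : WeierstrassCurve ℚ) [W₂.IsElliptic] (D₂ : ModularParametrizationData W₂ N),
          D₂.f = D₀.f → D₀.modularDegree ≤ D₂.modularDegree) →
        (∀ r : ℚ, ratPlusSymbol D₀.f r ≠ 0 → 0 ≤ padicValRat 3 (ratPlusSymbol D₀.f r)) →
        kuriharaVanishingOrder W₀ 3 D₀.f = 0 →
        ¬ ((haveI : Fact (Nat.Prime 3) := ⟨Nat.prime_three⟩; Addv W₀ 3) ∧
            ¬ 3 ∣ (W₀.baseChange ℚ_[3]).localTamagawaNumber ℤ_[3] ∧ ¬ (3 : ℤ) ∣ D₀.maninConstant) →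
        ∃ d : ℕ, kuriharaPartialDeepInfty W₀ 3 D₀.f = d ∧
          ((padicValNat 3 (Nat.card (AddCommGroup.primaryComponent W₀.sha 3)) + d : ℕ) : ℕ∞) ≤
            kuriharaPartial W₀ 3 D₀.f 0 := by
  intro W₀ _ _ htow ht _ N _ hN D₀ hopt _ hint hord hoff
  obtain ⟨v₃, η, hv₃, hη⟩ := exists_place_three_and_generators
  obtain ⟨e, hPort⟩ := hPortOff W₀ htow ht v₃ hv₃ η hη D₀ hN hopt hoff
  exact upper_row_of_portUnlocked hS24 hS24₂ hGZK hPT W₀ htow D₀ e hint hord v₃ hv₃ η hη hPort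

/-- **The LOWER twin 19679 `DeepLowerAtThreeOffKatoStratum` on its `E(ℚ₃)[3] = 0` rows ⟸ PUB ∧ PORT@3-OFF.**
[cite: Kim2022StructureSelmer, Thm. 1.9 (6), §1.5.1] [cite: MazurRubin2004, Def. 5.2.11, Thm. 5.2.12 (i)]
[cite: Sakamoto2024, Thm. 4.4 (p. 926)] -/
theorem deepLowerOff_torsionFree_of_portOff
    (hS24 : Sakamoto2024.kolyvaginSystems_freeRankOne_zmod_three_pow)
    (hS24₂ : Sakamoto2024.kolyvaginSystems_idealOfBasis_eq_fittingIdeal_zmod_three_pow)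
    (hGZK : rank_eq_analyticRank_of_analyticRank_le_one) (hPT : poitouTate_selmerStructure_duality ℚ) :
    ∀ (W₀ : WeierstrassCurve ℚ) [W₀.IsElliptic] [W₀.IsGloballyMinimal],
      (∀ n : ℕ, W₀.HasSurjectiveModNGaloisRep (3 ^ n : ℕ)) →
      Nat.card {Q : (W₀.baseChange ℚ_[3]).toAffine.Point // (3 : ℕ) • Q = 0} = 1 → Finite W₀.sha →
      ∀ {N : ℕ} [NeZero N], N = W₀.conductorNorm ℤ →
      ∀ (D₀ : ModularParametrizationData W₀ N),
        (∀ z ∈ D₀.L.lattice, ∃ w ∈ periodLattice D₀.f, z = D₀.c * w) →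
        (∀ (W₂ : WeierstrassCurve ℚ) [W₂.IsElliptic] (D₂ : ModularParametrizationData W₂ N),
          D₂.f = D₀.f → D₀.modularDegree ≤ D₂.modularDegree) →
        (∀ r : ℚ, ratPlusSymbol D₀.f r ≠ 0 → 0 ≤ padicValRat 3 (ratPlusSymbol D₀.f r)) →
        kuriharaVanishingOrder W₀ 3 D₀.f = 0 →
        ¬ ((haveI : Fact (Nat.Prime 3) := ⟨Nat.prime_three⟩; Addv W₀ 3) ∧
            ¬ 3 ∣ (W₀.baseChange ℚ_[3]).localTamagawaNumber ℤ_[3] ∧ ¬ (3 : ℤ) ∣ D₀.maninConstant) →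
        ∃ d : ℕ, kuriharaPartialDeepInfty W₀ 3 D₀.f = d ∧
          kuriharaPartial W₀ 3 D₀.f 0 ≤
            ((padicValNat 3 (Nat.card (AddCommGroup.primaryComponent W₀.sha 3)) + d : ℕ) : ℕ∞) := by
  intro W₀ _ _ htow ht _ N _ hN D₀ hopt _ hint hord hoff
  obtain ⟨v₃, η, hv₃, hη⟩ := exists_place_three_and_generators
  obtain ⟨e, hPort⟩ := hPortOff W₀ htow ht v₃ hv₃ η hη D₀ hN hopt hoff
  exact lower_row_of_portUnlocked hS24 hS24₂ hGZK hPT W₀ htow D₀ e hint hord v₃ hv₃ η hη hPort hN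

/-! ### §2 Crux 19077 and the LEAF from the alias 19678 and PORT@3-OFF -/

/-- **Crux 19077 `ShallowEqDeepAtTorsionFree` BY NAME ⟸ alias 19678 `KatoStratumSharedParts` ∧ PORT@3-OFF**:
kim3's glue `shallowEqDeepAtTorsionFree_of_katoStratumSharedParts` (ON the Kato stratum: PORT″ = crux 19560 and
w2-c4 g4's noStub shallow = deep row) fed with `shallowEqDeepOffKatoStratum_of_portOff` (OFF it).
[cite: Kim2025RefinedTNC, Thm. 1.1 and Thm. 1.2] [cite: Sakamoto2024, Thm. 4.4 (p. 926)]
[cite: MazurRubin2004, Thm. 4.4.1 and Thm. 5.2.12] [cite: Carayol1986] -/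
theorem shallowEqDeepAtTorsionFree_of_sharedParts_of_portOff (hParts : KatoStratumSharedParts) :
    ShallowEqDeepAtTorsionFree := by
  obtain ⟨hSak, hGZK, hPT, -, -⟩ := id hParts
  exact shallowEqDeepAtTorsionFree_of_katoStratumSharedParts hParts
    (shallowEqDeepOffKatoStratum_of_portOff hPortOff hSak.1 hSak.2 hGZK hPT)

/-- **Crux 19076 `DeepUpperAtThree` on its `E(ℚ₃)[3] = 0` rows, class-wide (every newform, every level) ⟸
alias 19678 ∧ PORT@3-OFF**: reduce to the optimal datum of the class at the conductor (BCDT + Edixhoven Prop. 2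
`exists_optimalDatum_of_isNewformOf`, Carayol `hlev`, kim3's isogeny invariance of the row and of `#E(ℚ₃)[3]`
under the tower), then ON the Kato stratum w2-c4 g4's `deepUpper_optimal_of_poitouTate_noStub` with PORT″, OFF it
`upper_row_of_portUnlocked` with PORT@3-OFF. [cite: Kim2025RefinedTNC, Thm 1.1] [cite: EdixhovenManin1991, Prop. 2]
[cite: Carayol1986] [cite: Sakamoto2024, Thm. 4.4 (p. 926)] [cite: SilvermanAEC2009, Cor. VII.7.2] -/
theorem deepUpper₀_classwide_of_sharedParts_of_portOff (hParts : KatoStratumSharedParts) :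
    ∀ (W : WeierstrassCurve ℚ) [W.IsElliptic] [W.IsGloballyMinimal],
      (∀ n : ℕ, W.HasSurjectiveModNGaloisRep (3 ^ n : ℕ)) →
      Nat.card {Q : (W.baseChange ℚ_[3]).toAffine.Point // (3 : ℕ) • Q = 0} = 1 →
      Finite W.sha →
      ∀ {N : ℕ} [NeZero N] (f : CuspForm (Gamma0 N) 2), IsNewformOf W f →
      (∀ r : ℚ, ratPlusSymbol f r ≠ 0 → 0 ≤ padicValRat 3 (ratPlusSymbol f r)) →
      kuriharaVanishingOrder W 3 f = 0 →
        ∃ d : ℕ, kuriharaPartialDeepInfty W 3 f = d ∧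
          ((padicValNat 3 (Nat.card (AddCommGroup.primaryComponent W.sha 3)) + d : ℕ) : ℕ∞) ≤
            kuriharaPartial W 3 f 0 := by
  obtain ⟨hSak, hGZK, hPT, hlev, hPort⟩ := hParts
  intro W _ _ htow ht0 _ N _ f hf hint hord
  haveI : Fact (Nat.Prime 3) := ⟨Nat.prime_three⟩
  have hirr : W.HasIrreducibleModPGaloisRep 3 := hasIrreducibleModPGaloisRep_of_tower htow
  obtain ⟨W₀, hW₀, hW₀', D₀, hf₀, hiso, hopt, -⟩ := exists_optimalDatum_of_isNewformOf hf
  have htow₀ : ∀ n : ℕ, W₀.HasSurjectiveModNGaloisRep (3 ^ n : ℕ) := towerSurjective_of_isIsogenous hiso htow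
  have ht0₀ : Nat.card {Q : (W₀.baseChange ℚ_[3]).toAffine.Point // (3 : ℕ) • Q = 0} = 1 := by
    rw [← natCard_torsion_padic_eq_of_isIsogenous hiso hirr]
    exact ht0
  have hN : N = W₀.conductorNorm ℤ := hlev _ D₀.isNewformOf
  have hint₀ : ∀ r : ℚ, ratPlusSymbol D₀.f r ≠ 0 → 0 ≤ padicValRat 3 (ratPlusSymbol D₀.f r) := by
    rw [hf₀]; exact hint
  have hord₀ : kuriharaVanishingOrder W₀ 3 D₀.f = 0 := by
    rw [hf₀, ← kuriharaVanishingOrder_eq_of_isIsogenous f hiso hirr]; exact hord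
  obtain ⟨v₃, η, hv₃, hη⟩ := exists_place_three_and_generators
  have h₀ : ∃ d : ℕ, kuriharaPartialDeepInfty W₀ 3 D₀.f = d ∧
      ((padicValNat 3 (Nat.card (AddCommGroup.primaryComponent W₀.sha 3)) + d : ℕ) : ℕ∞) ≤
        kuriharaPartial W₀ 3 D₀.f 0 := by
    by_cases hroad :
        ((haveI : Fact (Nat.Prime 3) := ⟨Nat.prime_three⟩; Addv W₀ 3) ∧
          ¬ 3 ∣ (W₀.baseChange ℚ_[3]).localTamagawaNumber ℤ_[3] ∧ ¬ (3 : ℤ) ∣ D₀.maninConstant)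
    · obtain ⟨hadd, hc3, hcD⟩ := hroad
      exact deepUpper_optimal_of_poitouTate_noStub hSak.1 hSak.2 hGZK hPT W₀ hadd hc3 htow₀ ht0₀ D₀ hopt hcD
        hint₀ hord₀ v₃ hv₃ η hη (hPort W₀ htow₀ hadd hc3 ht0₀ v₃ hv₃ η hη D₀ hN hopt hcD)
    · obtain ⟨e, hPortU⟩ := hPortOff W₀ htow₀ ht0₀ v₃ hv₃ η hη D₀ hN hopt hroad
      exact upper_row_of_portUnlocked hSak.1 hSak.2 hGZK hPT W₀ htow₀ D₀ e hint₀ hord₀ v₃ hv₃ η hη hPortU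
  rw [hf₀] at h₀
  exact (deepUpper_conclusion_iff_of_isIsogenous f hiso hirr).mpr h₀

/-- **THE ROUTE'S LEAF `N11.KimAtThreeRankZeroPUB` ⟸ alias 19678 `KatoStratumSharedParts` ∧ PORT@3-OFF.**
W2 reduced to PUBLISHED named facts (Sakamoto 2024 Thm. 4.4 (1)(2), Gross–Zagier–Kolyvagin, Poitou–Tate, Carayol)
and the Kato–Kurihara dictionary at `3` — PORT″ on the Kato stratum (crux 19560) and PORT@3 off it — ONE debt
class, FLAG `K22-Thm3.13-PORT@3`.  Composition: the class-wide upper row on the leaf's rows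
(`deepUpper₀_classwide_of_sharedParts_of_portOff`), (R)_all from the parts and (R)_off
(`KimAtThreeShallowEqDeepResidualSeam.residualAll_of_sharedParts_of_residualOff` ∘ `residualOff_of_portOff`), and
`kimAtThreeRankZeroPUB_of_upper₀_of_residual`.  Cruxes 19562 / 19679 / 19599 / 19075–19077, (R), TamDiv∞, (DD)
are not inputs. [cite: Kim2025RefinedTNC, Thm. 1.1] [cite: Kim2022StructureSelmer, Thm. 1.9 (6) and Thm. 3.13]
[cite: Sakamoto2024, Thm. 4.4 (p. 926)] [cite: MazurRubin2004, Thm. 4.4.1 and Thm. 5.2.12] [cite: Carayol1986] -/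
theorem kimAtThreeRankZeroPUB_of_sharedParts_of_portOff (hParts : KatoStratumSharedParts) :
    N11.KimAtThreeRankZeroPUB := by
  obtain ⟨hSak, hGZK, hPT, -, -⟩ := id hParts
  exact kimAtThreeRankZeroPUB_of_upper₀_of_residual
    (deepUpper₀_classwide_of_sharedParts_of_portOff hPortOff hParts)
    (residualAll_of_sharedParts_of_residualOff hParts
      (residualOff_of_portOff hPortOff hSak.1 hSak.2 hGZK hPT))

end PortOff

end Summit.BirchSwinnertonDyer.BirchSwinnertonDyer.Theorems.KimAtThreeShallowEqDeepPortSeam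

end
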